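import Literature.MathematicalPhysics.QuantumFieldTheory.Balaban1983to89.T4TermwiseInstantiate

/-!
# Bałaban 1983–89, node U5 / estimate NE7 (MATCHING MOD CONSTANTS), TERM-WISE route, generation 12 (fourth leaf):
# THE OSCILLATION BINDER (osc-U) REDUCED TO A PLAQUETTE-LEVEL INPUT — `hoscA` of generation 10's
# `interpolation_averaging_of_regular` (the two-level regularity of Bałaban's CONCRETE axial-gauge transport) PROVED
# from the covariant nearest-neighbour oscillation of the plaquette-log field at ONE scale, (44∇), by transport along
# lattice words; the decay LAW of (44∇) down the tower stays an INPUT, BY NAME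

HONEST FRAMING (cell `pub-balaban`, sub-cell t4, T4-DAG page 1).  Finite 4-torus, rung (B)+1 scoping: existence and
uniqueness of the `ε → 0` limit of unit-scale averaged expectations on a FIXED finite torus.  NOT infinite volume, NOT a
mass gap, NOT the Clay statement, NOT a proof of NE7 (NE7 is NOT PRINTED: the manuscripts under audit construct ONE
sequence of effective actions and never compare two runs).  CONDITIONALS, BY NAME, none hidden in a definition: the
capstone below is generation 12's `T4TermwiseInstantiate.interpolation_averaging_SU2_sz` with its (osc-U) hypotheses
`hoscA` + `hω` DISCHARGED from two NEW hypotheses stated at the level of ONE background configuration per scale —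
(44∇) `hAosc` : at every scale and every good term, for every plane `P ∈ planes`, every site `x` and every direction
`κ`, `‖V(x, x+e_κ) · log V(∂p_{x+e_κ}) · V(x, x+e_κ)⁻¹ − log V(∂p_x)‖ ≤ α₁(K)` (covariant nearest-neighbour oscillation of
the plaquette-log field of run A's background along the bond `⟨x, x+e_κ⟩`, B7 (9)), and its decay LAW `hα₁K` :
`0 ≤ α₁(K) ≤ c_{α1} ε₁ L^{−2(K+1)} L^{−K}` — an INPUT in the shape of a DERIVATIVE small-field bound on the background
(the covariant Hölder seminorm of the field strength at lattice spacing `L^{−(K+1)}` is `O(a³|∇F|)`), NOT derived here and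
NOT PRINTED as used (the cell's literature record places regularity of the backgrounds at [Balaban1985Variational]
pp. 280–286; nothing of it is quoted or invoked).  What this leaf proves is the TRANSPORT ALGEBRA between the two: the
window oscillation of the transported logs `Φ(y, x) = T_x log V(∂p_x) T_x⁻¹`, `T_x = u(La)⁻¹u(x)`, `u` the axial gauge
function of B7 p. 24 based at the far corner of the window, is at most `(|x − c|₁ + |x′ − c|₁)·α₁ ≤ 4dL·α₁`.
Upstream and untouched: (repr) `hreprU`/`hreprL`, the configuration hypotheses `hA`/`hB` ((44) per scale), `hαK`, the
(B)-type decay `hdecay`, (W-w), (0.31) = `h031A`/`h031B`, (B), (B^μ), everything of generations 7–9's census.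

CITATION HEADER (lean-in-tree rule 2026-08-18).  Audit cell `pub-balaban`, sub-cell t4 (unit b2b-balaban-t4-ne7-p1-g12).
No sentence of print is quoted in this file.  The objects are those of `B7Prop1Explicit` ((9) parallel transport along
words, the tree contour and the axial gauge of p. 24 of [Balaban1985Averaging], quoted verbatim THERE), `T4TermwiseTorus`
(windows, slots, the torus kernel `pker`), `T4TermwiseSU2` (the quaternion model of `SU(2)`, the transported datum `GM`,
`PhiQ`) and `T4TermwiseInstantiate` (the one-call instantiation).  Every declaration below is [folklore]: the telescoping
of a conjugated difference along a word and the isometry of conjugation by norm-bounded units.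

## What this module adds (namespace `…T4TermwiseOscillation`; nothing of another lineage is edited or bumped)
* §1 (any normed ring `𝔸`, bond variables in `U1 𝔸`): `norm_conj_sub_conj` (`‖uXu⁻¹ − uYu⁻¹‖ = ‖X − Y‖`),
  **`hol_conj_osc`** (TELESCOPING: if every one-letter covariant difference of a field `φ` is `≤ α₁`, then along any word
  `w`, `‖V(w) φ(x + disp w) V(w)⁻¹ − φ(x)‖ ≤ |w|·α₁`), `step_osc_of_bond_osc` (the one-letter hypothesis for both
  orientations from the forward-bond one).
* §2 (`SU(2)`, the quaternion model): `sub_mem_range`, `norm_topRowQuat_sub`, `farCorner` (the base point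
  `La + Le_μ + Le_ν` of the axial gauge of `T4TermwiseSU2.GM`), `GM_eq_conj`, **`norm_GM_sub_GM`**
  (`‖GM(y, p) − GM(y, p′)‖ ≤ (|p − c|₁ + |p′ − c|₁)·α₁`), `l1_zpos_sub_farCorner_le` (a window position is within
  `ℓ¹`-distance `2dL` of the far corner), **`norm_PhiQ_sub_PhiQ`** (generation 10's (osc-U) inequality at one level:
  `0 < pker y x → 0 < pker y x′ → ‖Φ_Q(y, x) − Φ_Q(y, x′)‖_ℍ ≤ 4dL·α₁`).
* §3 (`d = 4`, the tower): `cOSC` (`= 16·L·c_{α1}`) and the capstone **`interpolation_averaging_SU2_osc`** =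
  `interpolation_averaging_SU2_sz` with `hoscA`, `hω` DISCHARGED (`ω_K = 16L·α₁(K)`, `c₂ = cOSC L c_{α1}`).
* §4 toy (non-vacuity of (44∇)): the constant configuration has covariant oscillation `0` (`const_config_osc`).

## Binder status of `interpolation_averaging_of_regular` after this leaf (G = SU(2), Wilson terms)
DISCHARGED (theorems of the lineage): (wt) (ker) (cnt) (tr) (bch) (sz) (scal) and now the transport half of (osc-U).
REMAINING, BY NAME (hypotheses of `interpolation_averaging_SU2_osc`): (repr) `hreprU hreprL`; configurations `hA hB`
((44) per scale) and `hAosc` ((44∇) per scale, run A); smallness `hαK`; decays `hdecay` ((B)-type INPUT, `α₀(K)`) and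
`hα₁K` ((B∇)-type INPUT, `α₁(K)`), `hcα hε₁`; torus size `2 ≤ M`, `2 ≤ L`.  None of the remaining laws is printed as
used; NE7 remains NOT PRINTED and NOT PROVED.

## What is NOT delivered
Any derivation of (44∇) or of its law from (B)/(0.31) or from the variational problem; SU(N ≥ 3); terms other than
Wilson plaquette terms; the case `M = 1` at `K = 0`.  This file contains no estimate of print: it is transport algebra.
-/

noncomputable section

open scoped BigOperators Quaternion Matrix.Norms.L2Operator
open Finset

namespace Literature.MathematicalPhysics.QuantumFieldTheory.Balaban1983to89.T4TermwiseOscillation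

open B7Prop1Explicit B7Prop2Explicit B7Prop2SpecialUnitary T4TermwiseBCH T4TermwiseTorus T4TermwiseSU2 T4TermwiseQuartic
  T4TermwiseInstantiate
open Literature.MathematicalPhysics.QuantumLattice (quatMatrix)
open T4HaarSU2LocalDiffeo (topRowQuat topRowQuat_quatMatrix)
open T4QuatExpLog (quatMatrix_sub norm_quatMatrix)

/-! ## §1 Covariant oscillation along lattice words (any normed ring, bond variables in `U1`) -/

section Words

variable {d : ℕ} {𝔸 : Type*} [NormedRing 𝔸] [NormOneClass 𝔸]

/-- `‖uXu⁻¹ − uYu⁻¹‖ = ‖X − Y‖` for `u ∈ U1` (conjugation is an isometry, `T4TermwiseBCH.norm_units_conj_eq`).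
[folklore] -/
theorem norm_conj_sub_conj {u : 𝔸ˣ} (hu : u ∈ U1 𝔸) (X Y : 𝔸) :
    ‖(u : 𝔸) * X * ((u⁻¹ : 𝔸ˣ) : 𝔸) - (u : 𝔸) * Y * ((u⁻¹ : 𝔸ˣ) : 𝔸)‖ = ‖X - Y‖ := by
  rw [← norm_units_conj_eq hu (X - Y), mul_sub, sub_mul]

/-- **TELESCOPING ALONG A WORD.** If every one-letter covariant difference of a field `φ` on `ℤ^d` is at most `α₁`
(`‖V(b_l) φ(x + l) V(b_l)⁻¹ − φ(x)‖ ≤ α₁` for every site `x` and letter `l`, `V(b_l)` = `stepHol`, B7 (9)), then along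
every word `w` the transported field differs from the field at the start by at most `|w|·α₁`:
`‖V(w) φ(x + disp w) V(w)⁻¹ − φ(x)‖ ≤ |w|·α₁` (`V(w) = hol V x w`). [folklore] -/
theorem hol_conj_osc {V : B7Prop1Explicit.Site d → Fin d → 𝔸ˣ} (hV : ∀ x κ, V x κ ∈ U1 𝔸)
    (φ : B7Prop1Explicit.Site d → 𝔸) {α₁ : ℝ}
    (hstep : ∀ (x : B7Prop1Explicit.Site d) (l : Letter d),
      ‖((stepHol V x l : 𝔸ˣ) : 𝔸) * φ (x + l.vec) * (((stepHol V x l)⁻¹ : 𝔸ˣ) : 𝔸) - φ x‖ ≤ α₁) :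
    ∀ (w : List (Letter d)) (x : B7Prop1Explicit.Site d),
      ‖((hol V x w : 𝔸ˣ) : 𝔸) * φ (x + disp w) * (((hol V x w)⁻¹ : 𝔸ˣ) : 𝔸) - φ x‖ ≤ w.length * α₁
  | [], x => by simp
  | l :: w, x => by
    have ih := hol_conj_osc hV φ hstep w (x + l.vec)
    have hs : stepHol V x l ∈ U1 𝔸 := stepHol_mem_of hV x l
    rw [hol_cons, disp_cons, List.length_cons]
    have key : ((stepHol V x l * hol V (x + l.vec) w : 𝔸ˣ) : 𝔸) * φ (x + (l.vec + disp w))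
          * (((stepHol V x l * hol V (x + l.vec) w)⁻¹ : 𝔸ˣ) : 𝔸) - φ x
        = ((stepHol V x l : 𝔸ˣ) : 𝔸) * (((hol V (x + l.vec) w : 𝔸ˣ) : 𝔸) * φ (x + l.vec + disp w)
            * (((hol V (x + l.vec) w)⁻¹ : 𝔸ˣ) : 𝔸) - φ (x + l.vec)) * (((stepHol V x l)⁻¹ : 𝔸ˣ) : 𝔸)
          + (((stepHol V x l : 𝔸ˣ) : 𝔸) * φ (x + l.vec) * (((stepHol V x l)⁻¹ : 𝔸ˣ) : 𝔸) - φ x) := by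
      rw [mul_inv_rev, Units.val_mul, Units.val_mul, ← add_assoc]
      noncomm_ring
    rw [key]
    calc _ ≤ ‖((stepHol V x l : 𝔸ˣ) : 𝔸) * (((hol V (x + l.vec) w : 𝔸ˣ) : 𝔸) * φ (x + l.vec + disp w)
            * (((hol V (x + l.vec) w)⁻¹ : 𝔸ˣ) : 𝔸) - φ (x + l.vec)) * (((stepHol V x l)⁻¹ : 𝔸ˣ) : 𝔸)‖
          + ‖((stepHol V x l : 𝔸ˣ) : 𝔸) * φ (x + l.vec) * (((stepHol V x l)⁻¹ : 𝔸ˣ) : 𝔸) - φ x‖ := norm_add_le _ _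
      _ ≤ w.length * α₁ + α₁ := by
          rw [norm_units_conj_eq hs]
          exact add_le_add ih (hstep x l)
      _ = ((w.length + 1 : ℕ) : ℝ) * α₁ := by push_cast; ring

/-- The one-letter hypothesis of `hol_conj_osc` for BOTH orientations from the forward-bond one,
`‖V(x, x+e_κ) φ(x + e_κ) V(x, x+e_κ)⁻¹ − φ(x)‖ ≤ α₁` (backward letters by the isometry of conjugation). [folklore] -/
theorem step_osc_of_bond_osc {V : B7Prop1Explicit.Site d → Fin d → 𝔸ˣ} (hV : ∀ x κ, V x κ ∈ U1 𝔸)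
    (φ : B7Prop1Explicit.Site d → 𝔸) {α₁ : ℝ}
    (hbond : ∀ (x : B7Prop1Explicit.Site d) (κ : Fin d),
      ‖(V x κ : 𝔸) * φ (x + e κ) * (((V x κ)⁻¹ : 𝔸ˣ) : 𝔸) - φ x‖ ≤ α₁)
    (x : B7Prop1Explicit.Site d) (l : Letter d) :
    ‖((stepHol V x l : 𝔸ˣ) : 𝔸) * φ (x + l.vec) * (((stepHol V x l)⁻¹ : 𝔸ˣ) : 𝔸) - φ x‖ ≤ α₁ := by
  obtain ⟨κ, b⟩ := l
  cases b
  · rw [stepHol_false, Letter.vec_false, inv_inv, ← sub_eq_add_neg]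
    have h := hbond (x - e κ) κ
    rw [sub_add_cancel] at h
    have key : (((V (x - e κ) κ)⁻¹ : 𝔸ˣ) : 𝔸) * φ (x - e κ) * ((V (x - e κ) κ : 𝔸ˣ) : 𝔸) - φ x
        = (((V (x - e κ) κ)⁻¹ : 𝔸ˣ) : 𝔸)
            * (φ (x - e κ) - (V (x - e κ) κ : 𝔸) * φ x * (((V (x - e κ) κ)⁻¹ : 𝔸ˣ) : 𝔸))
            * ((((V (x - e κ) κ)⁻¹)⁻¹ : 𝔸ˣ) : 𝔸) := by
      rw [inv_inv, mul_sub, sub_mul, mul_assoc ((V (x - e κ) κ : 𝔸ˣ) : 𝔸) (φ x), Units.inv_mul_cancel_left,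
        Units.inv_mul_cancel_right]
    rw [key, norm_units_conj_eq ((U1 𝔸).inv_mem (hV _ _)), norm_sub_rev]
    exact h
  · rw [stepHol_true, Letter.vec_true]
    exact hbond x κ

end Words

/-! ## §2 `SU(2)`: the window oscillation of the transported datum `GM` and of `PhiQ` -/

section SU2

variable {d : ℕ}

/-- Differences of quaternion matrices are quaternion matrices. [folklore] -/
theorem sub_mem_range {A B : M₂} (hA : A ∈ Set.range quatMatrix) (hB : B ∈ Set.range quatMatrix) :
    A - B ∈ Set.range quatMatrix := by
  obtain ⟨p, rfl⟩ := hA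
  obtain ⟨q, rfl⟩ := hB
  exact ⟨p - q, quatMatrix_sub p q⟩

/-- Pull-back of a difference to `ℍ`: `‖topRowQuat A − topRowQuat B‖_ℍ = ‖A − B‖` for quaternion matrices.
[folklore] -/
theorem norm_topRowQuat_sub {A B : M₂} (hA : A ∈ Set.range quatMatrix) (hB : B ∈ Set.range quatMatrix) :
    ‖topRowQuat A - topRowQuat B‖ = ‖A - B‖ := by
  rw [← map_sub, norm_topRowQuat (sub_mem_range hA hB)]

/-- The base point of the axial gauge of `T4TermwiseSU2.GM` for the coarse label `y = (P, a)`: the far corner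
`La + Le_μ + Le_ν` of the window. [folklore] -/
def farCorner (L : ℕ) (y : (Fin d × Fin d) × B7Prop1Explicit.Site d) : B7Prop1Explicit.Site d :=
  (L : ℤ) • y.2 + (L : ℤ) • e y.1.1 + (L : ℤ) • e y.1.2

/-- `GM` as a conjugate: `GM(y, x′) = u(La)⁻¹ · (u(x′) log V(∂p_{x′}) u(x′)⁻¹) · u(La)`, `u = axialFn V c`, `c` the far
corner. [folklore] -/
theorem GM_eq_conj (L : ℕ) (V : B7Prop1Explicit.Site d → Fin d → M₂ˣ) (y : (Fin d × Fin d) × B7Prop1Explicit.Site d)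
    (x' : B7Prop1Explicit.Site d) :
    GM L V y x' = (((axialFn V (farCorner L y) ((L : ℤ) • y.2))⁻¹ : M₂ˣ) : M₂)
      * (((axialFn V (farCorner L y) x' : M₂ˣ) : M₂) * phiM V y.1 x'
          * (((axialFn V (farCorner L y) x')⁻¹ : M₂ˣ) : M₂))
      * ((((axialFn V (farCorner L y) ((L : ℤ) • y.2))⁻¹)⁻¹ : M₂ˣ) : M₂) := by
  simp only [GM, farCorner, mul_inv_rev, inv_inv, Units.val_mul, mul_assoc]

/-- **WINDOW OSCILLATION OF THE TRANSPORTED DATUM.** Under the one-letter covariant oscillation bound `α₁` for the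
plaquette-log field of the plane of `y`, `‖GM(y, p) − GM(y, p′)‖ ≤ (|p − c|₁ + |p′ − c|₁)·α₁`, `c` the far corner
(`hol_conj_osc` along the two tree contours from `c`, B7 p. 24, and the isometry of conjugation by `u(La)⁻¹`). [folklore] -/
theorem norm_GM_sub_GM (L : ℕ) {V : B7Prop1Explicit.Site d → Fin d → M₂ˣ}
    (hV : ∀ x κ, V x κ ∈ specialUnitaryUnits (Fin 2))
    (y : (Fin d × Fin d) × B7Prop1Explicit.Site d) {α₁ : ℝ}
    (hstep : ∀ (x : B7Prop1Explicit.Site d) (l : Letter d),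
      ‖((stepHol V x l : M₂ˣ) : M₂) * phiM V y.1 (x + l.vec) * (((stepHol V x l)⁻¹ : M₂ˣ) : M₂) - phiM V y.1 x‖ ≤ α₁)
    (p p' : B7Prop1Explicit.Site d) :
    ‖GM L V y p - GM L V y p'‖ ≤ ((l1 (p - farCorner L y) : ℝ) + l1 (p' - farCorner L y)) * α₁ := by
  have hU : ∀ x κ, V x κ ∈ U1 M₂ := U1_of_SU hV
  have hW : ∀ q : B7Prop1Explicit.Site d,
      ‖((axialFn V (farCorner L y) q : M₂ˣ) : M₂) * phiM V y.1 q * (((axialFn V (farCorner L y) q)⁻¹ : M₂ˣ) : M₂)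
        - phiM V y.1 (farCorner L y)‖ ≤ (l1 (q - farCorner L y) : ℝ) * α₁ := fun q => by
    have h := hol_conj_osc hU (phiM V y.1) hstep (treeWord (q - farCorner L y)) (farCorner L y)
    rw [disp_treeWord, show farCorner L y + (q - farCorner L y) = q by abel, length_treeWord] at h
    exact h
  rw [GM_eq_conj, GM_eq_conj, norm_conj_sub_conj ((U1 M₂).inv_mem (axialFn_mem hU _ _))]
  calc _ = ‖(((axialFn V (farCorner L y) p : M₂ˣ) : M₂) * phiM V y.1 p * (((axialFn V (farCorner L y) p)⁻¹ : M₂ˣ) : M₂)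
            - phiM V y.1 (farCorner L y))
          + (phiM V y.1 (farCorner L y) - ((axialFn V (farCorner L y) p' : M₂ˣ) : M₂) * phiM V y.1 p'
            * (((axialFn V (farCorner L y) p')⁻¹ : M₂ˣ) : M₂))‖ := by rw [sub_add_sub_cancel]
    _ ≤ _ := norm_add_le _ _
    _ ≤ (l1 (p - farCorner L y) : ℝ) * α₁ + (l1 (p' - farCorner L y) : ℝ) * α₁ :=
        add_le_add (hW p) (by rw [norm_sub_rev]; exact hW p')
    _ = _ := by ring

/-- A window position is within `ℓ¹`-distance `2dL` of the far corner (its coordinates relative to the corner `La` lie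
in `[0, 2L − 2]`, `T4TermwiseTorus.zpos_sub_corner_bounds`; the far corner's in `{0, L}`). [folklore] -/
theorem l1_zpos_sub_farCorner_le {L : ℕ} {μ ν : Fin d} (hμν : μ ≠ ν) (a : B7Prop1Explicit.Site d)
    {s : (Fin d → Fin L) × ℕ × ℕ} (hs : s ∈ slots L) :
    (l1 (zpos L μ ν ((L : ℤ) • a) s - ((L : ℤ) • a + (L : ℤ) • e μ + (L : ℤ) • e ν)) : ℝ) ≤ 2 * d * L := by
  have hκ : ∀ κ,
      ((zpos L μ ν ((L : ℤ) • a) s - ((L : ℤ) • a + (L : ℤ) • e μ + (L : ℤ) • e ν)) κ).natAbs ≤ 2 * L := by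
    intro κ
    have hb := zpos_sub_corner_bounds (L := L) hμν ((L : ℤ) • a) hs κ
    simp only [Pi.sub_apply, Pi.add_apply, Pi.smul_apply, smul_eq_mul, e_apply, mul_ite, mul_one, mul_zero] at hb ⊢
    by_cases h1 : κ = μ
    · have h2 : ¬κ = ν := fun h => hμν (h1 ▸ h)
      rw [if_pos h1, if_neg h2]; omega
    · by_cases h2 : κ = ν
      · rw [if_neg h1, if_pos h2]; omega
      · rw [if_neg h1, if_neg h2]; omega
  have hsum : l1 (zpos L μ ν ((L : ℤ) • a) s - ((L : ℤ) • a + (L : ℤ) • e μ + (L : ℤ) • e ν)) ≤ d * (2 * L) := by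
    unfold l1
    calc _ ≤ ∑ _κ : Fin d, 2 * L := Finset.sum_le_sum fun κ _ => hκ κ
      _ = d * (2 * L) := by simp
  calc _ ≤ ((d * (2 * L) : ℕ) : ℝ) := by exact_mod_cast hsum
    _ = 2 * d * L := by push_cast; ring

/-- **GENERATION 10's (osc-U) INEQUALITY AT ONE LEVEL, for Bałaban's concrete transport.** For an `SU(2)`-valued
configuration under (44) with the Prop. 2 smallness, whose plaquette-log field in the plane of `y` has one-letter covariant
oscillation `≤ α₁`, two fine labels in the support of the averaging kernel of `y` carry transported data at most
`4dL·α₁` apart in `ℍ`: `0 < pker y x → 0 < pker y x′ → ‖Φ_Q(y, x) − Φ_Q(y, x′)‖_ℍ ≤ 4dL·α₁`. [folklore] -/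
theorem norm_PhiQ_sub_PhiQ (T L : ℕ) {V : B7Prop1Explicit.Site d → Fin d → M₂ˣ}
    (hV : ∀ x κ, V x κ ∈ specialUnitaryUnits (Fin 2))
    (hL : 1 ≤ L) {α₀ : ℝ} (hα₀ : 0 ≤ α₀) (hsmall : 512 * (d + 1) * (d + 4) * (L : ℝ) ^ 2 * α₀ ≤ 1)
    (h44 : ∀ (x : B7Prop1Explicit.Site d) (κ κ' : Fin d), κ ≠ κ' →
      ‖((hol V x (plaqWord κ κ') : M₂ˣ) : M₂) - 1‖ ≤ α₀)
    {α₁ : ℝ} (hα₁ : 0 ≤ α₁) (y x x' : (Fin d × Fin d) × B7Prop1Explicit.Site d) (hy : y.1.1 ≠ y.1.2)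
    (hstep : ∀ (z : B7Prop1Explicit.Site d) (l : Letter d),
      ‖((stepHol V z l : M₂ˣ) : M₂) * phiM V y.1 (z + l.vec) * (((stepHol V z l)⁻¹ : M₂ˣ) : M₂) - phiM V y.1 z‖ ≤ α₁)
    (hx : 0 < pker T L y x) (hx' : 0 < pker T L y x') :
    ‖PhiQ T L V y x - PhiQ T L V y x'‖ ≤ 4 * (d : ℝ) * L * α₁ := by
  have key : ∀ {x : (Fin d × Fin d) × B7Prop1Explicit.Site d}, 0 < pker T L y x →
      ∃ s ∈ slots L, PhiQ T L V y x = topRowQuat (GM L V y (zpos L y.1.1 y.1.2 ((L : ℤ) • y.2) s)) := by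
    intro x hx
    unfold pker at hx
    split_ifs at hx with h
    · obtain ⟨s, hs, -, hG⟩ := textend_of_tker_ne_zero T L y.1.1 y.1.2 (GM L V y) (phiM V y.1) hx.ne'
      refine ⟨s, hs, ?_⟩
      rw [PhiQ, if_pos h.symm, hG]
    · exact absurd hx (lt_irrefl 0)
  have hGr : ∀ q, GM L V y q ∈ Set.range quatMatrix := fun q =>
    transport_mem_range hV _ _ q (mlog_hol_plaqWord_mem_range hV hL hα₀ hsmall h44 hy q)
  obtain ⟨s, hs, hPx⟩ := key hx
  obtain ⟨s', hs', hPx'⟩ := key hx'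
  rw [hPx, hPx', norm_topRowQuat_sub (hGr _) (hGr _)]
  calc _ ≤ ((l1 (zpos L y.1.1 y.1.2 ((L : ℤ) • y.2) s - farCorner L y) : ℝ)
          + l1 (zpos L y.1.1 y.1.2 ((L : ℤ) • y.2) s' - farCorner L y)) * α₁ := norm_GM_sub_GM L hV y hstep _ _
    _ ≤ (2 * d * L + 2 * d * L) * α₁ := by
        gcongr
        exacts [l1_zpos_sub_farCorner_le hy y.2 hs, l1_zpos_sub_farCorner_le hy y.2 hs']
    _ = 4 * (d : ℝ) * L * α₁ := by ring

end SU2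

/-! ## §3 `d = 4`, the tower: (osc-U) DISCHARGED from (44∇) and its decay law -/

/-- The constant `16·L·c_{α1}` of the (osc-U) law `ω_K ≤ c₂ ε₁ L^{−2(K+1)} L^{−K}` produced from the (44∇) law
(`ω_K = 4·d·L·α₁(K)`, `d = 4`). [folklore] -/
def cOSC (L : ℕ) (cα₁ : ℝ) : ℝ := 16 * (L : ℝ) * cα₁

section CapstoneOsc

variable {ι : Type} {σ : Type*} [DecidableEq σ] {l₀ : ℝ} {T : ℕ → Finset σ} {Bad : ℕ → ℝ → Finset σ} {Adm : Set ι}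

/-- **(U)(L) FOR `SU(2)` WILSON TERMS, (osc-U) DISCHARGED FROM (44∇)** — `T4TermwiseInstantiate.interpolation_averaging_SU2_sz`
with generation 10's `hoscA` supplied by `norm_PhiQ_sub_PhiQ` (`ω_K = 16L·α₁(K)`) and its law `hω` by the (44∇) decay
law (`c₂ = cOSC L c_{α1}`); the one-letter form needed by `norm_PhiQ_sub_PhiQ` comes from `step_osc_of_bond_osc`.  NEW
hypotheses, BY NAME: `hAosc` ((44∇) for run A's background at every scale and good term: forward-bond covariant
oscillation of `log V(∂p)` at most `α₁(K)` in every plane of `planes`) and `hα₁K`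
(`0 ≤ α₁(K) ≤ c_{α1} ε₁ L^{−2(K+1)} L^{−K}`, a (B∇)-type INPUT).  REMAINING hypotheses, BY NAME: `hαK`, `hA`, `hB`,
`hAosc`, `hcα`, `hdecay`, `hα₁K`, `hreprU`, `hreprL`, `hε₁`. [folklore] -/
theorem interpolation_averaging_SU2_osc {Y YA : Type*} {g : ℕ → ℝ → σ → ι → YA → ℝ}
    {f₁ : ℕ → ℝ → σ → ι → Y → ℝ} {Q : ℕ → ℝ → σ → ι → Y → YA} {yA yB : ℕ → ℝ → σ → ι → Y}
    {xA : ℕ → ℝ → σ → ι → YA}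
    (M L : ℕ) (hM : 2 ≤ M) (hL : 2 ≤ L) (planes : Finset (Fin 4 × Fin 4)) (hplanes : ∀ P ∈ planes, P.1 ≠ P.2)
    (VA VB : ℕ → ℝ → σ → ι → (B7Prop1Explicit.Site 4 → Fin 4 → M₂ˣ))
    {αK α₁K : ℕ → ℝ} {cα cα₁ ε₁ : ℝ}
    (hαK : ∀ K, 0 ≤ αK K ∧ 20480 * (L : ℝ) ^ 2 * αK K ≤ 1)
    (hA : ∀ K t, |t| ≤ l₀ → ∀ τ ∈ T K \ Bad K t, ∀ v ∈ Adm,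
      (∀ x κ, VA K t τ v x κ ∈ specialUnitaryUnits (Fin 2)) ∧ IsPeriodic (M * L ^ K * L) (VA K t τ v) ∧
        ∀ (x : B7Prop1Explicit.Site 4) (κ κ' : Fin 4), κ ≠ κ' →
          ‖((hol (VA K t τ v) x (plaqWord κ κ') : M₂ˣ) : M₂) - 1‖ ≤ αK K)
    (hB : ∀ K t, |t| ≤ l₀ → ∀ τ ∈ T K \ Bad K t, ∀ v ∈ Adm,
      (∀ x κ, VB K t τ v x κ ∈ specialUnitaryUnits (Fin 2)) ∧ IsPeriodic (M * L ^ K * L) (VB K t τ v) ∧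
        ∀ (x : B7Prop1Explicit.Site 4) (κ κ' : Fin 4), κ ≠ κ' →
          ‖((hol (VB K t τ v) x (plaqWord κ κ') : M₂ˣ) : M₂) - 1‖ ≤ αK K)
    (hAosc : ∀ K t, |t| ≤ l₀ → ∀ τ ∈ T K \ Bad K t, ∀ v ∈ Adm, ∀ P ∈ planes,
      ∀ (z : B7Prop1Explicit.Site 4) (κ : Fin 4),
        ‖((VA K t τ v z κ : M₂ˣ) : M₂) * phiM (VA K t τ v) P (z + e κ)
            * (((VA K t τ v z κ)⁻¹ : M₂ˣ) : M₂) - phiM (VA K t τ v) P z‖ ≤ α₁K K)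
    (hcα : 0 ≤ cα) (hdecay : ∀ K, αK K ≤ cα * ε₁ * (((L : ℝ) ^ K)⁻¹) ^ 2)
    (hα₁K : ∀ K, 0 ≤ α₁K K ∧ α₁K K ≤ cα₁ * ε₁ * (((L : ℝ) ^ (K + 1))⁻¹) ^ 2 * ((L : ℝ) ^ K)⁻¹)
    (hreprU : ∀ K t, |t| ≤ l₀ → ∀ τ ∈ T K \ Bad K t, ∀ v ∈ Adm,
      f₁ K t τ v (yA K t τ v) = ∑ x ∈ pbox planes (M * L ^ K * L), eQ (phiQ (VA K t τ v) x) ∧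
        g K t τ v (xA K t τ v) = ∑ y ∈ pbox planes (M * L ^ K), eQ (psiQ L (VA K t τ v) y))
    (hreprL : ∀ K t, |t| ≤ l₀ → ∀ τ ∈ T K \ Bad K t, ∀ v ∈ Adm,
      f₁ K t τ v (yB K t τ v) = ∑ x ∈ pbox planes (M * L ^ K * L), eQ (phiQ (VB K t τ v) x) ∧
        g K t τ v (Q K t τ v (yB K t τ v)) = ∑ y ∈ pbox planes (M * L ^ K), eQ (psiQ L (VB K t τ v) y))
    (hε₁ : 0 ≤ ε₁) :
    (∀ K t, |t| ≤ l₀ → ∀ τ ∈ T K \ Bad K t, ∀ v ∈ Adm,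
      f₁ K t τ v (yA K t τ v) - g K t τ v (xA K t τ v)
        ≤ (M : ℝ) ^ 4 * ((planes.card : ℝ) * (cOSC L cα₁ ^ 2 * ε₁ ^ 2 / 4 + cSZ L cα * cBCH L cα * ε₁ ^ 3
            + 1 / 24 * (cSZ L cα * ε₁ + cBCH L cα * ε₁ ^ 2) ^ 4) * (((L : ℝ) ^ 2)⁻¹) ^ K)) ∧
    (∀ K t, |t| ≤ l₀ → ∀ τ ∈ T K \ Bad K t, ∀ v ∈ Adm,
      g K t τ v (Q K t τ v (yB K t τ v)) - f₁ K t τ v (yB K t τ v)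
        ≤ (M : ℝ) ^ 4 * ((planes.card : ℝ) * (cSZ L cα * cBCH L cα * ε₁ ^ 3 + cBCH L cα ^ 2 * ε₁ ^ 4 / 2
            + 1 / 24 * (cSZ L cα ^ 4 * ε₁ ^ 4)) * (((L : ℝ) ^ 2)⁻¹) ^ K)) ∧
    (∀ K, 0 ≤ (planes.card : ℝ) * (cOSC L cα₁ ^ 2 * ε₁ ^ 2 / 4 + cSZ L cα * cBCH L cα * ε₁ ^ 3
        + 1 / 24 * (cSZ L cα * ε₁ + cBCH L cα * ε₁ ^ 2) ^ 4) * (((L : ℝ) ^ 2)⁻¹) ^ K) ∧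
    (∀ K, 0 ≤ (planes.card : ℝ) * (cSZ L cα * cBCH L cα * ε₁ ^ 3 + cBCH L cα ^ 2 * ε₁ ^ 4 / 2
        + 1 / 24 * (cSZ L cα ^ 4 * ε₁ ^ 4)) * (((L : ℝ) ^ 2)⁻¹) ^ K) ∧
    Summable (fun K => (planes.card : ℝ) * (cOSC L cα₁ ^ 2 * ε₁ ^ 2 / 4 + cSZ L cα * cBCH L cα * ε₁ ^ 3
        + 1 / 24 * (cSZ L cα * ε₁ + cBCH L cα * ε₁ ^ 2) ^ 4) * (((L : ℝ) ^ 2)⁻¹) ^ K) ∧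
    Summable (fun K => (planes.card : ℝ) * (cSZ L cα * cBCH L cα * ε₁ ^ 3 + cBCH L cα ^ 2 * ε₁ ^ 4 / 2
        + 1 / 24 * (cSZ L cα ^ 4 * ε₁ ^ 4)) * (((L : ℝ) ^ 2)⁻¹) ^ K) := by
  have hL1 : 1 ≤ L := by omega
  have hL0 : (0 : ℝ) ≤ L := Nat.cast_nonneg L
  exact interpolation_averaging_SU2_sz (ω := fun K => 4 * ((4 : ℕ) : ℝ) * (L : ℝ) * α₁K K) (c₂ := cOSC L cα₁)
    M L hM hL planes hplanes VA VB hαK hA hB hcα hdecay hreprU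
    (fun K t ht τ hτ v hv y hy x _ x' _ hpos hpos' =>
      norm_PhiQ_sub_PhiQ (M * L ^ K * L) L (hA K t ht τ hτ v hv).1 hL1 (hαK K).1 (smallness_four (hαK K).2)
        (hA K t ht τ hτ v hv).2.2 (hα₁K K).1 y x x' (hplanes y.1 (Finset.mem_product.1 hy).1)
        (step_osc_of_bond_osc (U1_of_SU (hA K t ht τ hτ v hv).1) (phiM (VA K t τ v) y.1)
          (hAosc K t ht τ hτ v hv y.1 (Finset.mem_product.1 hy).1)) hpos hpos')
    hreprL hε₁
    (fun K => ⟨by have h0 := (hα₁K K).1; positivity,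
      calc 4 * ((4 : ℕ) : ℝ) * (L : ℝ) * α₁K K = 16 * (L : ℝ) * α₁K K := by push_cast; ring
        _ ≤ 16 * (L : ℝ) * (cα₁ * ε₁ * (((L : ℝ) ^ (K + 1))⁻¹) ^ 2 * ((L : ℝ) ^ K)⁻¹) :=
            mul_le_mul_of_nonneg_left (hα₁K K).2 (by positivity)
        _ = cOSC L cα₁ * ε₁ * (((L : ℝ) ^ (K + 1))⁻¹) ^ 2 * ((L : ℝ) ^ K)⁻¹ := by unfold cOSC; ring⟩)

end CapstoneOsc

/-! ## §4 Toy (non-vacuity of (44∇)): the constant configuration has covariant oscillation `0` -/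

section Toy

/-- The constant `SU(2)` configuration `1` meets (44∇) with `α₁ = 0` in every plane: its plaquette logs vanish and its
bond variables are `1`. [folklore] -/
theorem const_config_osc {d : ℕ} (P : Fin d × Fin d) (z : B7Prop1Explicit.Site d) (κ : Fin d) :
    ‖(((fun (_ : B7Prop1Explicit.Site d) (_ : Fin d) => (1 : M₂ˣ)) z κ : M₂ˣ) : M₂)
        * phiM (fun (_ : B7Prop1Explicit.Site d) (_ : Fin d) => (1 : M₂ˣ)) P (z + e κ)
        * ((((fun (_ : B7Prop1Explicit.Site d) (_ : Fin d) => (1 : M₂ˣ)) z κ)⁻¹ : M₂ˣ) : M₂)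
      - phiM (fun (_ : B7Prop1Explicit.Site d) (_ : Fin d) => (1 : M₂ˣ)) P z‖ ≤ 0 := by
  simp [phiM, hol_const_one]

end Toy

end Literature.MathematicalPhysics.QuantumFieldTheory.Balaban1983to89.T4TermwiseOscillation
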